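import Summits.Ventures.PercRepro.Night2DQm1Cell
import Summits.Ventures.PercRepro.Night2SevenFiveSeven

/-!
# PercRepro — THE `(7, 5)` CELLS `(4, 2)` AND `(4, 1)`; THE ROW MODULO FIVE CELLS (night-2, gen 19)

The regime `|E ∖ G| = q − 1` at `q = 5` with `kColoops = 2`, i.e. `ρ = 4` (`G ∖ K` of rank `4`).  The constants are
`λ = lambdaDQ 5 4 2 = 11/180` and `c′ = cPrimeDQ 5 4 2 = 13/90`, and the target sum reads
`dqm1Sum n 5 4 2 = ((13/90) A₄(n) + n + 1) / ((11/45) C(n, 4))` (`dqm1Sum_eq`), so the cell needs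

  `22 · C(n, 4) ≤ 13 · A₄(n) + 90 (n + 1)`   for every `n ≥ 6`   (`four_two_ineq`),

checked directly for `n = 6, …, 9` (`A₄ = 0, 21, 84, 246`; the minimum ratio `1.235` sits at `n = 8`) and for `n ≥ 10`
from `A₄(n) ≥ C(n, 5) + C(n, 6) ≥ 2 C(n, 4)` (`(n − 4)(n + 1) ≥ 60`).  Hence **`localShadowHall_four_two_five`**: the
local form (LI_G) at every rank-`6` flat with `|E ∖ G| = 4` and `kColoops = 2` of every simple loopless matroid — the
`(7, 5)` cell `(4, 2)` (`proofs/NIGHT-2-g19.md` §3).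

## The cell `(4, 1)`


The regime `|E ∖ G| = q − 1` at `q = 5` with `kColoops = 1`, i.e. `ρ = 5` (`G ∖ K` of rank `5`).  The constants are
`λ = lambdaDQ 5 5 1 = 37/900` and `c′ = cPrimeDQ 5 5 1 = 11/60`, and the target sum reads
`dqm1Sum n 5 5 1 = ((11/60) A₅(n) + n + 1) / ((37/180) C(n, 5))` (`dqm1Sum_eq`), so the cell needs

  `37 · C(n, 5) ≤ 33 · A₅(n) + 180 (n + 1)`   for every `n ≥ 7`   (`four_one_ineq`),

checked directly for `n = 7, 8, 9` (`A₅ = 0, 28, 120`; the minimum ratio `1.228` sits at `n = 8`) and for `n ≥ 10`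
from `A₅(n) ≥ C(n, 6) + C(n, 7)` with `42 (C(n, 6) + C(n, 7)) = (n − 5)(n + 1) C(n, 5) ≥ 55 C(n, 5)`.  Hence
**`localShadowHall_four_one_five`**: the local form (LI_G) at every rank-`6` flat with `|E ∖ G| = 4` and
`kColoops = 1` of every simple loopless matroid — the `(7, 5)` cell `(4, 1)` (`proofs/NIGHT-2-g19.md` §3).

## The row modulo five cells


`shadowHall_seven_five_of_local_seven` (gen 18) reduced the `(7, 5)` shadow row to the seven local cells
`(|E ∖ G|, kColoops) ∈ {(2,0), (2,1), (3,0), (3,1), (3,2), (4,1), (4,2)}` of loopless simple rank-`7` matroids.  The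
cells `(4, 2)` and `(4, 1)` are kernel theorems (`localShadowHall_four_two_five`, `localShadowHall_four_one_five`:
the regime `|E ∖ G| = q − 1` under the fair-share loss routing), so **`shadowHall_seven_five_of_local_d_le_three`**: the
`(7, 5)` shadow row — hence the C-025 body at `(7, 5)` through `c025_of_shadowHall` — for every finite matroid
modulo the FIVE cells `(2,0), (2,1), (3,0), (3,1), (3,2)` alone, all with `|E ∖ G| ≤ 3`.
-/

namespace PercRepro.Shadow

open Finset PerFlat ThmH

namespace DQm1

/-- `λ = 11/180` at `(q, ρ, k) = (5, 4, 2)`. -/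
theorem lambdaDQ_five_four_two : lambdaDQ 5 4 2 = 11 / 180 := by
  unfold lambdaDQ capDQ phiQ; norm_num

/-- `c′ = 13/90` at `(q, ρ, k) = (5, 4, 2)`. -/
theorem cPrimeDQ_five_four_two : cPrimeDQ 5 4 2 = 13 / 90 := by
  unfold cPrimeDQ capDQ phiQ; norm_num

/-- `C(n, 5) + C(n, 6) ≥ 2 C(n, 4)` for `n ≥ 10`. -/
theorem two_choose_four_le {n : ℕ} (hn : 10 ≤ n) : 2 * n.choose 4 ≤ n.choose 5 + n.choose 6 := by
  obtain ⟨m, rfl⟩ : ∃ m, n = m + 10 := ⟨n - 10, by omega⟩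
  have h5 := Nat.choose_succ_right_eq (m + 10) 4
  have h6 := Nat.choose_succ_right_eq (m + 10) 5
  rw [show m + 10 - 4 = m + 6 by omega] at h5
  rw [show m + 10 - 5 = m + 5 by omega] at h6
  nlinarith [h5, h6, Nat.zero_le ((m + 10).choose 4), Nat.zero_le ((m + 10).choose 5)]

/-- The base cases `n = 6, 7, 8, 9` of the `(4, 2)` inequality. -/
theorem four_two_ineq_small {n : ℕ} (hn : 6 ≤ n) (hn' : n ≤ 9) :
    22 * n.choose 4 ≤ 13 * Aρ n 4 + 90 * (n + 1) := by
  interval_cases n <;> decide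

/-- **The `(4, 2)` inequality**: `22 C(n, 4) ≤ 13 A₄(n) + 90 (n + 1)` for every `n ≥ 6`. -/
theorem four_two_ineq {n : ℕ} (hn : 6 ≤ n) : 22 * n.choose 4 ≤ 13 * Aρ n 4 + 90 * (n + 1) := by
  by_cases h : n ≤ 9
  · exact four_two_ineq_small hn h
  · push Not at h
    have hA : n.choose 5 + n.choose 6 ≤ Aρ n 4 := Aρ_ge_two (by omega)
    have h2 := two_choose_four_le (by omega : 10 ≤ n)
    omega

/-- **The target sum of the cell `(4, 2)` is at least `1`** for every `n ≥ 6`. -/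
theorem one_le_dqm1Sum_four_two {n : ℕ} (hn : 6 ≤ n) : 1 ≤ dqm1Sum n 5 4 2 := by
  have hlam : 0 < lambdaDQ 5 4 2 := by rw [lambdaDQ_five_four_two]; norm_num
  rw [dqm1Sum_eq (by omega) (by norm_num) hlam, lambdaDQ_five_four_two, cPrimeDQ_five_four_two]
  have hC : (0 : ℚ) < (n.choose 4 : ℚ) := by exact_mod_cast Nat.choose_pos (by omega)
  rw [le_div_iff₀ (by positivity)]
  have key := four_two_ineq hn
  have key' : (22 : ℚ) * (n.choose 4 : ℚ) ≤ 13 * (Aρ n 4 : ℚ) + 90 * ((n : ℚ) + 1) := by exact_mod_cast key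
  linarith

end DQm1

variable {α : Type*} [DecidableEq α] {M : Matroid α} [M.Finite]

open scoped Classical in
/-- **THE `(7, 5)` CELL `(4, 2)`**: a simple loopless matroid, a rank-`6` flat `G` with `|E ∖ G| = 4` and
`kColoops (M|G) = 2` satisfies the local form at `q = 5`. -/
theorem localShadowHall_four_two_five {G : Finset α} (hG : G ∈ flatsQ M (5 + 1))
    (hd : (gr M \ G).card = 4) (hk : kColoops M G = 2)
    (hs : ∀ e ∈ gr M, ∀ f ∈ gr M, e ≠ f → rkN M {e, f} = 2) (hl : ∀ e ∈ gr M, M.Indep {e}) :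
    LocalShadowHall M 5 G :=
  localShadowHall_dqm1_of_sum (ρ := 4) hG (by rw [hd]) (by rw [hk]) (by norm_num) hs hl
    (fun n hn => by rw [hk]; exact DQm1.one_le_dqm1Sum_four_two hn)


/-! ## The cell `(4, 1)` -/

namespace DQm1

/-- `λ = 37/900` at `(q, ρ, k) = (5, 5, 1)`. -/
theorem lambdaDQ_five_five_one : lambdaDQ 5 5 1 = 37 / 900 := by
  unfold lambdaDQ capDQ phiQ; norm_num

/-- `c′ = 11/60` at `(q, ρ, k) = (5, 5, 1)`. -/
theorem cPrimeDQ_five_five_one : cPrimeDQ 5 5 1 = 11 / 60 := by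
  unfold cPrimeDQ capDQ phiQ; norm_num

/-- `33 (C(n, 6) + C(n, 7)) ≥ 37 C(n, 5)` for `n ≥ 10`. -/
theorem choose_five_le {n : ℕ} (hn : 10 ≤ n) : 37 * n.choose 5 ≤ 33 * (n.choose 6 + n.choose 7) := by
  obtain ⟨m, rfl⟩ : ∃ m, n = m + 10 := ⟨n - 10, by omega⟩
  have h6 := Nat.choose_succ_right_eq (m + 10) 5
  have h7 := Nat.choose_succ_right_eq (m + 10) 6
  rw [show m + 10 - 5 = m + 5 by omega] at h6
  rw [show m + 10 - 6 = m + 4 by omega] at h7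
  nlinarith [h6, h7, Nat.zero_le ((m + 10).choose 5), Nat.zero_le ((m + 10).choose 6)]

/-- The base cases `n = 7, 8, 9` of the `(4, 1)` inequality. -/
theorem four_one_ineq_small {n : ℕ} (hn : 7 ≤ n) (hn' : n ≤ 9) :
    37 * n.choose 5 ≤ 33 * Aρ n 5 + 180 * (n + 1) := by
  interval_cases n <;> decide

/-- **The `(4, 1)` inequality**: `37 C(n, 5) ≤ 33 A₅(n) + 180 (n + 1)` for every `n ≥ 7`. -/
theorem four_one_ineq {n : ℕ} (hn : 7 ≤ n) : 37 * n.choose 5 ≤ 33 * Aρ n 5 + 180 * (n + 1) := by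
  by_cases h : n ≤ 9
  · exact four_one_ineq_small hn h
  · push Not at h
    have hA : n.choose 6 + n.choose 7 ≤ Aρ n 5 := Aρ_ge_two (by omega)
    have h2 := choose_five_le (by omega : 10 ≤ n)
    omega

/-- **The target sum of the cell `(4, 1)` is at least `1`** for every `n ≥ 7`. -/
theorem one_le_dqm1Sum_four_one {n : ℕ} (hn : 7 ≤ n) : 1 ≤ dqm1Sum n 5 5 1 := by
  have hlam : 0 < lambdaDQ 5 5 1 := by rw [lambdaDQ_five_five_one]; norm_num
  rw [dqm1Sum_eq (by omega) (by norm_num) hlam, lambdaDQ_five_five_one, cPrimeDQ_five_five_one]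
  have hC : (0 : ℚ) < (n.choose 5 : ℚ) := by exact_mod_cast Nat.choose_pos (by omega)
  rw [le_div_iff₀ (by positivity)]
  have key := four_one_ineq hn
  have key' : (37 : ℚ) * (n.choose 5 : ℚ) ≤ 33 * (Aρ n 5 : ℚ) + 180 * ((n : ℚ) + 1) := by exact_mod_cast key
  linarith

end DQm1


open scoped Classical in
/-- **THE `(7, 5)` CELL `(4, 1)`**: a simple loopless matroid, a rank-`6` flat `G` with `|E ∖ G| = 4` and
`kColoops (M|G) = 1` satisfies the local form at `q = 5`. -/
theorem localShadowHall_four_one_five {G : Finset α} (hG : G ∈ flatsQ M (5 + 1))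
    (hd : (gr M \ G).card = 4) (hk : kColoops M G = 1)
    (hs : ∀ e ∈ gr M, ∀ f ∈ gr M, e ≠ f → rkN M {e, f} = 2) (hl : ∀ e ∈ gr M, M.Indep {e}) :
    LocalShadowHall M 5 G :=
  localShadowHall_dqm1_of_sum (ρ := 5) hG (by rw [hd]) (by rw [hk]) (by norm_num) hs hl
    (fun n hn => by rw [hk]; exact DQm1.one_le_dqm1Sum_four_one hn)


/-! ## The `(7, 5)` row modulo five cells -/

section SevenFive

variable {α' : Type} [DecidableEq α']

/-- **THE `(7, 5)` SHADOW ROW FOR EVERY FINITE MATROID MODULO FIVE LOCAL CELLS**: if the local form (LI_G) holds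
for loopless simple rank-`7` matroids at every rank-`6` flat `G` with `2 ≤ |E ∖ G| ≤ 3`, `kColoops + 1 ≤ |E ∖ G|`
and `kColoops ≥ |E ∖ G| − 3`, then `ShadowHall M 7 5 (phiK 7 5)` for every finite matroid `M`. -/
theorem shadowHall_seven_five_of_local_d_le_three
    (hloc5 : ∀ (N : Matroid α') [N.Finite], (∀ e ∈ gr N, ∀ f ∈ gr N, e ≠ f → rkN N {e, f} = 2) →
      (∀ e ∈ gr N, N.Indep {e}) → N.eRank = ((5 + 2 : ℕ) : ℕ∞) →
      ∀ G ∈ flatsQ N (5 + 1), 2 ≤ (gr N \ G).card → (gr N \ G).card ≤ 3 →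
        kColoops N G + 1 ≤ (gr N \ G).card → 1 ≤ kColoops N G + 4 - (gr N \ G).card → LocalShadowHall N 5 G)
    (M : Matroid α') [M.Finite] : ShadowHall M 7 5 (phiK 7 5) :=
  shadowHall_seven_five_of_local_seven
    (fun N _ hs hl hr G hG h2 h4 hk1 hk2 _ => by
      by_cases hd3 : (gr N \ G).card ≤ 3
      · exact hloc5 N hs hl hr G hG h2 hd3 hk1 hk2
      · have hd4 : (gr N \ G).card = 4 := by omega
        have hk : kColoops N G = 1 ∨ kColoops N G = 2 ∨ kColoops N G = 3 := by omega
        rcases hk with hk | hk | hk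
        · exact localShadowHall_four_one_five hG hd4 hk hs hl
        · exact localShadowHall_four_two_five hG hd4 hk hs hl
        · exact localShadowHall_four_three_five hG hd4 hk hs) M

end SevenFive


end PercRepro.Shadow
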